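import Summits.QuantumFields.YangMills.Theorems.CurvatureBoostCovariance.Negative.Unbundled
import Summits.QuantumFields.YangMills.Theorems.NPointIsotropy.Negative.HyperoctahedralPlane
import Literature.MathematicalPhysics.QuantumFieldTheory.OSReconstructionNoE1
import Literature.MathematicalPhysics.QuantumFieldTheory.OSEuclideanRotationGenerator
import Literature.MathematicalPhysics.QuantumLattice.SchwartzNuclearExpansionBounds

/-!
# Ray positivity of the doubled pencils, I: the analytic core — stub `stub_rayPositivityCore`

Line `boosts-inherit-mirrors` of crux `MirrorModularBoosts.CurvatureBoostCovariance`
(stmt-QuantumFields-9663), Stub 4b of the registered skeleton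
`Cruxes/CurvatureBoostCovariance/Lines/boosts_inherit_mirrors.lean`.  First of the two files that
prove Stub 4 (`stub_rayPositivity`, in `…CurvatureBoostCovarianceRayPositivity.lean`, which imports
this file); Stub 4 as a whole is closed MODULO the registered input `stub_planarBoostVectors`
(Stub 4a, the boosted OS vectors), which the second file takes as an explicit hypothesis.

Statement (`stub_rayPositivityCore`; pure Hilbert-space complex analysis, model-blind).  Let
`VF, VG : ℂ → H` be holomorphic on the strip `{|Re θ| < ε}` of a complex inner product space `H`,
and let the four pairings `θ ↦ ⟪V•(-θ), V•(θ)⟫` (`• ∈ {F, G}`) on the real segment `|θ| < ε` be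
trigonometric polynomials `Σ_k c_k e^{4ikθ}` with coefficients `p, q, q', r`.  Then for every
`s > 0` and `v, w ∈ ℂ` the `2 × 2` Laurent pencil
`z = v̄v Σ p_k s^k + v̄w Σ q_k s^k + w̄v Σ q'_k s^k + w̄w Σ r_k s^k` is real and `≥ 0`.

Proof.  Write `s = e^{-4χ}`.  The map `θ ↦ ⟪VF(-θ̄), VG(θ)⟫` is holomorphic on the strip (the bra is
antiholomorphic and sits in the conjugate-linear slot: `hasDerivAt_innerSL_neg_conj`) and agrees
with the entire function `Σ q_k e^{4ikθ}` on the real segment, which accumulates at `0`; by the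
identity theorem on the (convex) strip they agree at `θ = iχ`, where `-θ̄ = θ` and
`e^{4ik(iχ)} = s^k`: `Σ q_k s^k = ⟪VF(iχ), VG(iχ)⟫` (`pencil_eq_inner`).  Hence
`z = ‖v VF(iχ) + w VG(iχ)‖²` (`gram_form`), real and non-negative.

The file also carries the model-blind geometry consumed by the second file: the rotated doubled
witness `R_θ(ΘF* ⊗ G) = Θ(R_{-θ}F)* ⊗ R_θ G` (`R_θ = planeRot 0 θ`, the rotation of the
`(x₀,x₁)`-plane of `ℝ⁴`), the margin of a compact time-ordered support under small rotations, angle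
addition for the diagonal action, the quarter shift `e^{4ik(θ+π/4)} = (-1)^k e^{4ikθ}` with the sign
twist `(-1)^k c (-s)^k = c s^k`, and the invariance of the Schwartz norms under the diagonal action
of an isometry (transport of E0' to the `45°` pull-back).

References: Osterwalder–Schrader, *Axioms for Euclidean Green's functions* (1973), §4 (Euclidean
covariance by analytic continuation in the rotation angle); Glimm–Jaffe, *Quantum Physics* (1987),
§6.1 (OS reconstruction, Gram forms of field vectors); the identity theorem is Mathlib's
`AnalyticOnNhd.eqOn_zero_of_preconnected_of_frequently_eq_zero`.
-/

noncomputable section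

-- tree-known workaround (kept in every landed `Negative/*.lean` file):
attribute [-instance] SimplexCategory.instFintypeToTypeOrderHomFinHAddNatLenOfNat

namespace Summit.QuantumFields.YangMills.Theorems.CurvatureBoostCovariance.BoostsInheritMirrors

open scoped BigOperators SchwartzMap InnerProductSpace ComplexConjugate
open MeasureTheory Filter Topology
open Literature.MathematicalPhysics.QuantumLattice Literature.MathematicalPhysics.AQFT
  Literature.MathematicalPhysics.QuantumFieldTheory
open Summit.QuantumFields.YangMills.Theorems.NPointIsotropy.Negative (E4)

namespace RayPositivity

/-! ## The Gram form and the antiholomorphic bra -/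

section Core

variable {H : Type*} [NormedAddCommGroup H] [InnerProductSpace ℂ H]

/-- **The pencil form is a squared norm.**  In a complex inner product space,
`v̄v ⟪x,x⟫ + v̄w ⟪x,y⟫ + w̄v ⟪y,x⟫ + w̄w ⟪y,y⟫ = ⟪v x + w y, v x + w y⟫`. -/
theorem gram_form (x y : H) (v w : ℂ) :
    conj v * v * ⟪x, x⟫_ℂ + conj v * w * ⟪x, y⟫_ℂ + conj w * v * ⟪y, x⟫_ℂ + conj w * w * ⟪y, y⟫_ℂ =
      ⟪v • x + w • y, v • x + w • y⟫_ℂ := by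
  simp only [inner_add_left, inner_add_right, inner_smul_left, inner_smul_right]
  ring

/-- **Antiholomorphic bra.**  If `V` has derivative `v'` at `-θ̄`, then the bra-valued map
`z ↦ ⟪V(-z̄), ·⟫ = innerSL ℂ (V (-z̄))` has derivative `-⟪v', ·⟫` at `θ` (the conjugation of the
argument and the conjugate-linearity of `innerSL` cancel). -/
theorem hasDerivAt_innerSL_neg_conj {V : ℂ → H} {v' : H} {θ : ℂ}
    (hV : HasDerivAt V v' (-conj θ)) :
    HasDerivAt (fun z : ℂ => innerSL ℂ (V (-conj z))) (-(innerSL ℂ v')) θ := by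
  set ψ : ℂ → ℂ := fun z => -conj z with hψ
  have hψt : Tendsto ψ (𝓝 θ) (𝓝 (-conj θ)) := Complex.continuous_conj.neg.tendsto θ
  -- the little-o of `V` at `-θ̄`, pulled back along `ψ`
  have h1 : (fun z => V (ψ z) - V (ψ θ) - (ψ z - ψ θ) • v') =o[𝓝 θ] fun z => ψ z - ψ θ :=
    (hasDerivAt_iff_isLittleO.1 hV).comp_tendsto hψt
  have h2 : (fun z => ψ z - ψ θ) =O[𝓝 θ] fun z => z - θ := by
    refine Asymptotics.IsBigO.of_bound 1 (Filter.Eventually.of_forall fun z => ?_)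
    have : ψ z - ψ θ = -conj (z - θ) := by simp [hψ, map_sub]; ring
    rw [this, norm_neg, Complex.norm_conj, one_mul]
  refine hasDerivAt_iff_isLittleO.2 (Asymptotics.IsLittleO.of_norm_left ?_)
  refine ((h1.trans_isBigO h2).norm_left).congr_left fun z => ?_
  -- the two remainders have the same norm (`innerSL` is a conjugate-linear isometry)
  have hrem : innerSL ℂ (V (ψ z) - V (ψ θ) - (ψ z - ψ θ) • v') =
      innerSL ℂ (V (-conj z)) - innerSL ℂ (V (-conj θ)) - (z - θ) • (-(innerSL ℂ v')) := by
    rw [map_sub, map_sub, map_smulₛₗ]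
    simp only [hψ, map_sub, map_neg, starRingEnd_self_apply, smul_neg, neg_smul, sub_smul]
    abel
  rw [← hrem, innerSL_apply_norm]

/-- The strip `{|Re θ| < ε}` is open. -/
theorem isOpen_reStrip (ε : ℝ) : IsOpen {θ : ℂ | |θ.re| < ε} :=
  isOpen_lt (continuous_abs.comp Complex.continuous_re) continuous_const

/-- The strip `{|Re θ| < ε}` is convex. -/
theorem convex_reStrip (ε : ℝ) : Convex ℝ {θ : ℂ | |θ.re| < ε} := by
  have hre : IsLinearMap ℝ fun w : ℂ => w.re :=
    ⟨fun u v => Complex.add_re u v, fun c u => Complex.smul_re c u⟩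
  have : {θ : ℂ | |θ.re| < ε} = {θ : ℂ | -ε < θ.re} ∩ {θ : ℂ | θ.re < ε} := by
    ext θ; simp [abs_lt]
  rw [this]
  exact (convex_halfSpace_gt hre _).inter (convex_halfSpace_lt hre _)

/-- **Identity theorem on the strip.**  If `V, W` are holomorphic on `{|Re θ| < ε}` and the pairing
`⟪V(-θ), W(θ)⟫` is the trigonometric polynomial `Σ c_k e^{4ikθ}` for real `|θ| < ε`, then at the
imaginary angle `iχ` the Laurent pencil at `s = e^{-4χ}` is the pairing of the boosted vectors:
`Σ c_k s^k = ⟪V(iχ), W(iχ)⟫`. -/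
theorem pencil_eq_inner {ε : ℝ} (hε : 0 < ε) {V W : ℂ → H}
    (hV : DifferentiableOn ℂ V {θ : ℂ | |θ.re| < ε}) (hW : DifferentiableOn ℂ W {θ : ℂ | |θ.re| < ε})
    (K : ℕ) (c : ℤ → ℂ)
    (hc : ∀ θ : ℝ, |θ| < ε → ⟪V (-(θ : ℂ)), W θ⟫_ℂ =
      ∑ k ∈ Finset.Icc (-(K : ℤ)) K, c k * Complex.exp (4 * (k : ℂ) * (θ : ℂ) * Complex.I))
    (χ : ℝ) :
    ∑ k ∈ Finset.Icc (-(K : ℤ)) K, c k * ((Real.exp (-4 * χ) : ℝ) : ℂ) ^ k =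
      ⟪V ((χ : ℂ) * Complex.I), W ((χ : ℂ) * Complex.I)⟫_ℂ := by
  set D : Set ℂ := {θ : ℂ | |θ.re| < ε} with hD
  have hDo : IsOpen D := isOpen_reStrip ε
  have hmemD : ∀ θ ∈ D, -conj θ ∈ D := fun θ hθ => by
    simp only [hD, Set.mem_setOf_eq, Complex.neg_re, Complex.conj_re, abs_neg] at hθ ⊢; exact hθ
  -- the trigonometric polynomial, an entire function
  set P : ℂ → ℂ := fun θ =>
    ∑ k ∈ Finset.Icc (-(K : ℤ)) K, c k * Complex.exp (4 * (k : ℂ) * θ * Complex.I) with hP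
  have hPd : Differentiable ℂ P := by
    simp only [hP]
    refine Differentiable.fun_sum fun k _ => (Differentiable.cexp ?_).const_mul _
    exact ((differentiable_id.const_mul _).mul_const _)
  -- the pairing minus the polynomial, holomorphic on the strip
  set g : ℂ → ℂ := fun θ => ⟪V (-conj θ), W θ⟫_ℂ - P θ with hg
  have hgd : DifferentiableOn ℂ g D := by
    intro θ hθ
    have hVat : HasDerivAt V (deriv V (-conj θ)) (-conj θ) :=
      ((hV _ (hmemD θ hθ)).differentiableAt (hDo.mem_nhds (hmemD θ hθ))).hasDerivAt
    have hWat : HasDerivAt W (deriv W θ) θ :=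
      ((hW _ hθ).differentiableAt (hDo.mem_nhds hθ)).hasDerivAt
    have h2 : DifferentiableAt ℂ (fun z => (innerSL ℂ (V (-conj z))) (W z)) θ :=
      ((hasDerivAt_innerSL_neg_conj hVat).clm_apply hWat).differentiableAt
    simp only [innerSL_apply_apply] at h2
    exact (h2.sub (hPd θ)).differentiableWithinAt
  have hga : AnalyticOnNhd ℂ g D := hgd.analyticOnNhd hDo
  -- `g` vanishes on the real segment, which accumulates at `0`
  have hfreq : ∃ᶠ θ in 𝓝[≠] (0 : ℂ), g θ = 0 := by
    have htend : Tendsto (fun s : ℝ => (s : ℂ)) (𝓝[>] 0) (𝓝[≠] 0) := by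
      have h1 : Tendsto (fun s : ℝ => (s : ℂ)) (𝓝[>] 0) (𝓝[{0}ᶜ] ((0 : ℝ) : ℂ)) :=
        Complex.continuous_ofReal.continuousWithinAt.tendsto_nhdsWithin fun s hs =>
          Complex.ofReal_ne_zero.2 (ne_of_gt hs)
      simpa using h1
    have hev : ∀ᶠ s : ℝ in 𝓝[>] 0, g (s : ℂ) = 0 := by
      have : ∀ᶠ s : ℝ in 𝓝[>] (0 : ℝ), s < ε :=
        (eventually_lt_nhds hε).filter_mono nhdsWithin_le_nhds
      filter_upwards [this, self_mem_nhdsWithin] with s hs hs0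
      have habs : |s| < ε := abs_lt.2 ⟨by linarith [Set.mem_Ioi.1 hs0], hs⟩
      simp only [hg, Complex.conj_ofReal, hP]
      rw [hc s habs, sub_self]
    exact htend.frequently hev.frequently
  have h0D : (0 : ℂ) ∈ D := by simp [hD, hε]
  have hzero := hga.eqOn_zero_of_preconnected_of_frequently_eq_zero
    (convex_reStrip ε).isPreconnected h0D hfreq
  have hχD : (χ : ℂ) * Complex.I ∈ D := by simp [hD, hε]
  have hval := hzero hχD
  simp only [hg, Pi.zero_apply, sub_eq_zero] at hval
  have hconj : -conj ((χ : ℂ) * Complex.I) = (χ : ℂ) * Complex.I := by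
    simp [map_mul, Complex.conj_ofReal, Complex.conj_I]
  rw [hconj] at hval
  rw [hval, hP]
  refine Finset.sum_congr rfl fun k _ => ?_
  congr 1
  rw [Complex.ofReal_exp, ← Complex.exp_int_mul]
  congr 1
  push_cast
  ring_nf
  rw [Complex.I_sq]
  ring

end Core

end RayPositivity

/-- **Stub 4b — the core of ray positivity (identity theorem on a strip + Gram form).**  If
`VF, VG : ℂ → H` are holomorphic on the strip `{|Re θ| < ε}` and the four pairings
`θ ↦ ⟪V•(-θ), V•(θ)⟫` on the real segment `|θ| < ε` are trigonometric polynomials in `e^{4iθ}` with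
coefficients `p, q, q', r`, then for every `s > 0` the `2 × 2` Laurent pencil at `s` is the Gram
form `‖v VF(iχ) + w VG(iχ)‖²` (`s = e^{-4χ}`), hence real and non-negative.  Registered signature of
the skeleton `Cruxes/CurvatureBoostCovariance/Lines/boosts_inherit_mirrors.lean`, verbatim. -/
theorem stub_rayPositivityCore :
    ∀ (H : Type) [NormedAddCommGroup H] [InnerProductSpace ℂ H] (ε : ℝ), 0 < ε →
      ∀ (VF VG : ℂ → H), DifferentiableOn ℂ VF {θ : ℂ | |θ.re| < ε} →
        DifferentiableOn ℂ VG {θ : ℂ | |θ.re| < ε} →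
      ∀ (Kp Kq Kq' Kr : ℕ) (p q q' r : ℤ → ℂ),
        (∀ θ : ℝ, |θ| < ε → ⟪VF (-(θ : ℂ)), VF θ⟫_ℂ =
          ∑ k ∈ Finset.Icc (-(Kp : ℤ)) Kp, p k * Complex.exp (4 * (k : ℂ) * (θ : ℂ) * Complex.I)) →
        (∀ θ : ℝ, |θ| < ε → ⟪VF (-(θ : ℂ)), VG θ⟫_ℂ =
          ∑ k ∈ Finset.Icc (-(Kq : ℤ)) Kq, q k * Complex.exp (4 * (k : ℂ) * (θ : ℂ) * Complex.I)) →
        (∀ θ : ℝ, |θ| < ε → ⟪VG (-(θ : ℂ)), VF θ⟫_ℂ =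
          ∑ k ∈ Finset.Icc (-(Kq' : ℤ)) Kq', q' k * Complex.exp (4 * (k : ℂ) * (θ : ℂ) * Complex.I)) →
        (∀ θ : ℝ, |θ| < ε → ⟪VG (-(θ : ℂ)), VG θ⟫_ℂ =
          ∑ k ∈ Finset.Icc (-(Kr : ℤ)) Kr, r k * Complex.exp (4 * (k : ℂ) * (θ : ℂ) * Complex.I)) →
        ∀ s : ℝ, 0 < s → ∀ v w : ℂ,
          (fun z : ℂ => 0 ≤ z.re ∧ z.im = 0)
            ((∑ k ∈ Finset.Icc (-(Kp : ℤ)) Kp, starRingEnd ℂ v * v * (p k * (s : ℂ) ^ k)) +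
            (∑ k ∈ Finset.Icc (-(Kq : ℤ)) Kq, starRingEnd ℂ v * w * (q k * (s : ℂ) ^ k)) +
            (∑ k ∈ Finset.Icc (-(Kq' : ℤ)) Kq', starRingEnd ℂ w * v * (q' k * (s : ℂ) ^ k)) +
            (∑ k ∈ Finset.Icc (-(Kr : ℤ)) Kr, starRingEnd ℂ w * w * (r k * (s : ℂ) ^ k))) := by
  intro H _ _ ε hε VF VG hVF hVG Kp Kq Kq' Kr p q q' r hp hq hq' hr s hs v w
  -- `s = e^{-4χ}`
  set χ : ℝ := -(Real.log s) / 4 with hχ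
  have hsχ : ((Real.exp (-4 * χ) : ℝ) : ℂ) = (s : ℂ) := by
    rw [hχ, show -4 * (-Real.log s / 4) = Real.log s by ring, Real.exp_log hs]
  set x : H := VF ((χ : ℂ) * Complex.I)
  set y : H := VG ((χ : ℂ) * Complex.I)
  have hP : ∑ k ∈ Finset.Icc (-(Kp : ℤ)) Kp, p k * (s : ℂ) ^ k = ⟪x, x⟫_ℂ := by
    rw [← hsχ]; exact RayPositivity.pencil_eq_inner hε hVF hVF Kp p hp χ
  have hQ : ∑ k ∈ Finset.Icc (-(Kq : ℤ)) Kq, q k * (s : ℂ) ^ k = ⟪x, y⟫_ℂ := by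
    rw [← hsχ]; exact RayPositivity.pencil_eq_inner hε hVF hVG Kq q hq χ
  have hQ' : ∑ k ∈ Finset.Icc (-(Kq' : ℤ)) Kq', q' k * (s : ℂ) ^ k = ⟪y, x⟫_ℂ := by
    rw [← hsχ]; exact RayPositivity.pencil_eq_inner hε hVG hVF Kq' q' hq' χ
  have hR : ∑ k ∈ Finset.Icc (-(Kr : ℤ)) Kr, r k * (s : ℂ) ^ k = ⟪y, y⟫_ℂ := by
    rw [← hsχ]; exact RayPositivity.pencil_eq_inner hε hVG hVG Kr r hr χ
  show 0 ≤ Complex.re _ ∧ Complex.im _ = 0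
  simp only [← Finset.mul_sum, hP, hQ, hQ', hR]
  rw [RayPositivity.gram_form x y v w]
  exact ⟨by exact_mod_cast inner_self_nonneg (𝕜 := ℂ) (x := v • x + w • y),
    by exact_mod_cast inner_self_im (𝕜 := ℂ) (v • x + w • y)⟩

namespace RayPositivity

/-! ## Laurent bookkeeping for the diagonal rays: the quarter shift and the sign twist -/

/-- **`e^{4ik(θ+π/4)} = (-1)^k e^{4ikθ}`**: shifting the angle by `π/4` twists the `k`-th orbit
coefficient by `(-1)^k`. -/
theorem exp_shift_quarter (k : ℤ) (θ : ℂ) :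
    Complex.exp (4 * (k : ℂ) * (θ + (Real.pi / 4 : ℝ)) * Complex.I) =
      (-1) ^ k * Complex.exp (4 * (k : ℂ) * θ * Complex.I) := by
  have h : 4 * (k : ℂ) * (θ + (Real.pi / 4 : ℝ)) * Complex.I =
      k * (Real.pi * Complex.I) + 4 * (k : ℂ) * θ * Complex.I := by
    push_cast; ring
  rw [h, Complex.exp_add, Complex.exp_int_mul, Complex.exp_pi_mul_I]

/-- **`(-1)^k c (-s)^k = c s^k`**: the twist cancels against the sign of the ray. -/
theorem twist_cancel (c : ℂ) (s : ℝ) (k : ℤ) :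
    (-1) ^ k * c * (((-s : ℝ) : ℂ)) ^ k = c * (s : ℂ) ^ k := by
  have hneg : (-(s : ℂ)) ^ k = (-1) ^ k * (s : ℂ) ^ k := by
    rw [neg_eq_neg_one_mul, mul_zpow]
  rw [Complex.ofReal_neg, hneg]
  calc (-1) ^ k * c * ((-1) ^ k * (s : ℂ) ^ k) = ((-1) ^ k * (-1) ^ k) * (c * (s : ℂ) ^ k) := by ring
    _ = c * (s : ℂ) ^ k := by rw [← mul_zpow, neg_one_mul, neg_neg, one_zpow, one_mul]

/-! ## Geometry of the doubled orbit in `ℝ⁴`: `R_θ(ΘF* ⊗ G) = Θ(R_{-θ}F)* ⊗ R_θ G`, margins -/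

/-- **`R_{-θ}⁻¹ Θ = Θ R_θ⁻¹` on `ℝ⁴`**: the time reflection conjugates the `(x₀,x₁)`-rotation to
its inverse. -/
theorem planeRot_symm_timeReflection (θ : ℝ) (u : E4) :
    (planeRot (0 : Fin 3) (-θ)).symm (timeReflection (3 + 1) u) =
      timeReflection 4 ((planeRot (0 : Fin 3) θ).symm u) := by
  rw [planeRot_symm_apply, planeRot_symm_apply, neg_neg]
  ext j
  fin_cases j
  all_goals simp [planeRot_apply, timeReflection_apply]
  all_goals ring

/-- **The rotated doubled witness.**  If `H = ΘF* ⊗ G` then `R_θ H = Θ(R_{-θ}F)* ⊗ R_θ G`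
(`linActMulti` acts diagonally; the OS adjoint reverses the arguments and reflects the time, and
`Θ R_θ = R_{-θ} Θ`). -/
theorem isAppendTensorOf_linActMulti_planeRot {n m : ℕ} {F : 𝓢((Fin n → E4), ℂ)}
    {G : 𝓢((Fin m → E4), ℂ)} {H : 𝓢((Fin (n + m) → E4), ℂ)}
    (hH : IsAppendTensorOf H (osAdjoint F) G) (θ : ℝ) :
    IsAppendTensorOf (linActMulti (planeRot (0 : Fin 3) θ) H)
      (osAdjoint (linActMulti (planeRot (0 : Fin 3) (-θ)) F))
      (linActMulti (planeRot (0 : Fin 3) θ) G) := by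
  intro x
  rw [linActMulti_apply, hH]
  simp only [osAdjoint_apply, linActMulti_apply, Function.comp_apply, planeRot_symm_timeReflection]
  rfl

/-- **Margin of a compact time-ordered support**: small rotations of a compactly supported
`e₀`-time-ordered test function are still `e₀`-time-ordered (tube lemma over the compact support in
the open ordered chamber, `eventually_forall_planeRot_mem_timeOrderedRegion`). -/
theorem exists_isTimeOrdered_planeRot {n : ℕ} {F : 𝓢((Fin n → E4), ℂ)} (hF : IsTimeOrdered F)
    (hFc : HasCompactSupport (F : (Fin n → E4) → ℂ)) :
    ∃ δ : ℝ, 0 < δ ∧ ∀ θ : ℝ, |θ| < δ → IsTimeOrdered (linActMulti (planeRot (0 : Fin 3) θ) F) := by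
  obtain ⟨δ, hδ, hball⟩ := Metric.eventually_nhds_iff.1
    (eventually_forall_planeRot_mem_timeOrderedRegion (0 : Fin 3) hFc.isCompact hF)
  refine ⟨δ, hδ, fun θ hθ => ?_⟩
  have hθ' : dist θ 0 < δ := by simpa [Real.dist_eq] using hθ
  intro x hx
  set L : (Fin n → E4) → (Fin n → E4) := fun x i => (planeRot (0 : Fin 3) θ).symm (x i) with hL
  have hLc : Continuous L :=
    continuous_pi fun i => (planeRot (0 : Fin 3) θ).symm.continuous.comp (continuous_apply i)
  have hcoe : ((linActMulti (planeRot (0 : Fin 3) θ) F : 𝓢((Fin n → E4), ℂ)) : (Fin n → E4) → ℂ) =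
      (F : (Fin n → E4) → ℂ) ∘ L := by
    funext y; simp [hL, linActMulti_apply]
  have hLx : L x ∈ tsupport (F : (Fin n → E4) → ℂ) := by
    have hx' : x ∈ tsupport ((F : (Fin n → E4) → ℂ) ∘ L) := by rw [← hcoe]; exact hx
    exact tsupport_comp_subset_preimage _ hLc hx'
  have hmem := hball hθ' (L x) hLx
  have hback : (fun k => planeRot (0 : Fin 3) θ (L x k)) = x := by
    funext k; simp [hL]
  rwa [hback] at hmem

/-- Composition of inverse plane rotations: `R_b⁻¹ (R_a⁻¹ u) = R_{a+b}⁻¹ u`. -/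
theorem planeRot_symm_symm (a b : ℝ) (u : E4) :
    (planeRot (0 : Fin 3) b).symm ((planeRot (0 : Fin 3) a).symm u) =
      (planeRot (0 : Fin 3) (a + b)).symm u := by
  simp only [planeRot_symm_apply]
  ext j
  fin_cases j
  all_goals simp [planeRot_apply, Real.cos_add, Real.sin_add, Real.cos_neg, Real.sin_neg]
  all_goals ring

/-- **Angle addition for the diagonal action**: `R_a · (R_b · X) = R_{a+b} · X`. -/
theorem linActMulti_planeRot_planeRot {N : ℕ} (a b : ℝ) (X : 𝓢((Fin N → E4), ℂ)) :
    linActMulti (planeRot (0 : Fin 3) a) (linActMulti (planeRot (0 : Fin 3) b) X) =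
      linActMulti (planeRot (0 : Fin 3) (a + b)) X := by
  ext x
  simp only [linActMulti_apply]
  congr 1
  funext i
  exact planeRot_symm_symm a b (x i)

/-! ## The diagonal action of an isometry does not increase Schwartz norms -/

/-- The diagonal action of an isometry on `(ℝ⁴)ᴺ` (sup norm) has operator norm `≤ 1`. -/
theorem norm_piCongrRight_le {N : ℕ} (L : E4 ≃ₗᵢ[ℝ] E4) :
    ‖((ContinuousLinearEquiv.piCongrRight fun _ : Fin N => L.toContinuousLinearEquiv :
        (Fin N → E4) ≃L[ℝ] (Fin N → E4)) : (Fin N → E4) →L[ℝ] (Fin N → E4))‖ ≤ 1 := by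
  refine ContinuousLinearMap.opNorm_le_bound _ zero_le_one fun x => ?_
  rw [one_mul, pi_norm_le_iff_of_nonneg (norm_nonneg x)]
  intro i
  calc ‖((ContinuousLinearEquiv.piCongrRight fun _ : Fin N => L.toContinuousLinearEquiv :
          (Fin N → E4) ≃L[ℝ] (Fin N → E4)) : (Fin N → E4) →L[ℝ] (Fin N → E4)) x i‖ = ‖L (x i)‖ := rfl
    _ = ‖x i‖ := L.norm_map _
    _ ≤ ‖x‖ := norm_le_pi_norm x i

/-- **Schwartz norms are not increased by the diagonal action of an isometry** (chain rule,
`schwartzNorm_compCLMOfContinuousLinearEquiv_le`, with both operator norms `≤ 1`). -/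
theorem schwartzNorm_linActMulti_le {N : ℕ} (L : E4 ≃ₗᵢ[ℝ] E4) (M : ℕ) (X : 𝓢((Fin N → E4), ℂ)) :
    schwartzNorm M (linActMulti L X) ≤ schwartzNorm M X := by
  have h := NuclearExpansion.schwartzNorm_compCLMOfContinuousLinearEquiv_le M
    (ContinuousLinearEquiv.piCongrRight fun _ : Fin N => L.symm.toContinuousLinearEquiv :
      (Fin N → E4) ≃L[ℝ] (Fin N → E4)) X
  have hsymm : ((ContinuousLinearEquiv.piCongrRight fun _ : Fin N => L.symm.toContinuousLinearEquiv :
      (Fin N → E4) ≃L[ℝ] (Fin N → E4)).symm : (Fin N → E4) →L[ℝ] (Fin N → E4)) =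
      ((ContinuousLinearEquiv.piCongrRight fun _ : Fin N => L.toContinuousLinearEquiv :
        (Fin N → E4) ≃L[ℝ] (Fin N → E4)) : (Fin N → E4) →L[ℝ] (Fin N → E4)) := by
    ext x i; rfl
  rw [hsymm, max_eq_left (max_le (norm_piCongrRight_le L) (norm_piCongrRight_le L.symm)),
    one_pow, one_mul] at h
  exact h

end RayPositivity

end Summit.QuantumFields.YangMills.Theorems.CurvatureBoostCovariance.BoostsInheritMirrors

end
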